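import Mathlib
import HarnessLib
import Summits.HubbardSuperconductivity.HubbardSuperconductivity.Theorems.KLProgrammeThermalGreenMatsubaraWordAllU

/-!
# `L¹(du)` convergence of a word correlation along a time curve, for EVERY coupling — the frequency-uniform control of
# Fourier–Matsubara coefficients of composite correlations (seat hubbard-kl-k3c4-p2, g3; «Matsubara all-U route»; file 3 of 3)

Continuation of `…ThermalGreenMatsubaraWordMoments` / `…ThermalGreenMatsubaraWordAllU`.  For a continuous curve of external times
`u ↦ s(u) ∈ [0,β)^k` (`u ∈ [0,β)`; e.g. `s(u) = (u,u,u,0,0,0)`: a composite field at time `u` against one at time `0`) and ANY pointwise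
`M → ∞` limit `N_∞(u)` of `N_M(u) := ∫dμ_{C_M} W_M(s(u)) e^{−V}` on `[0,β)` (file 2 identifies it as the limit-determinant series):

* **`tendsto_integral_norm_sub_word_allU`** — `∫_{[0,β]} ‖N_M(u) − N_∞(u)‖ du ⟶ 0` (dominated convergence: pointwise limit + the
  `u`-uniform bound of `exists_uniform_bound_gaussExpect_word_allU`, measurability from `continuous_gaussExpect_word`);
* **`tendsto_integral_norm_sub_wordRatio_allU`** — the same for the RATIOS `N_M/z_M − N_∞/z_∞` whenever `z_M → z_∞ ≠ 0`, and
  **`tendsto_integral_norm_sub_wordRatio_effPartitionFn_allU`** — `z_M = ∫dμ_{C_M}e^{−V}`, `z_∞ = e^{−βUL²/4}Z_{H'}/Z_{H₀}` (t2, `L ≥ 3`);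
* `norm_setIntegral_cexp_mul_sub_le` — `‖∫_S e^{iωu}(f − g)‖ ≤ ∫_S ‖f − g‖` for EVERY real `ω`.

USE (stub `stub_vl_bound` of stmt-HubbardSuperconductivity-19858, all-`U` route): once the six-point piece `b_M(ω,k)` of the finite-`M`
Schwinger–Dyson form is written as a `u`-Fourier–Matsubara coefficient of such a normalised composite correlation (k3c5-p3's Fourier form),
these give `sup_{ω} |b_M(ω,k) − b_∞(ω,k)| ≤ Σ_z ∫|S_M − S_∞| → 0` at fixed `L`, uniformly over the moving frequency window; the
`L`-uniform bound of `b_∞(ω_m,k)` at each FIXED Matsubara integer is then the Hamiltonian side's (`…ThermalGreenHubbardTorusExact`).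
Everything is proved; no definition; no smallness.
-/

namespace Summit.HubbardSuperconductivity.HubbardSuperconductivity.Theorems.MatsubaraAllU

set_option linter.dupNamespace false -- summit = problem name (single-conjunct summit), D-0017

open MeasureTheory Finset Filter Topology Literature.MathematicalPhysics.QuantumLattice
  Literature.Probability.LatticeModels
open Literature.MathematicalPhysics.QuantumLattice.GrassmannAlgebra
open scoped Nat ComplexOrder

noncomputable section

/-- On `[0,β]`, almost every time lies in `[0,β)`. -/
theorem ae_restrict_Icc_mem_Ico (β : ℝ) : ∀ᵐ u ∂(volume.restrict (Set.Icc (0 : ℝ) β)), u ∈ Set.Ico (0 : ℝ) β := by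
  rw [ae_restrict_iff' measurableSet_Icc]
  have hβnull : ∀ᵐ u ∂(volume : Measure ℝ), u ∉ ({β} : Set ℝ) :=
    measure_eq_zero_iff_ae_notMem.1 Real.volume_singleton
  filter_upwards [hβnull] with u hu huI
  exact ⟨huI.1, lt_of_le_of_ne huI.2 fun h => hu (Set.mem_singleton_iff.2 h)⟩

variable {L : ℕ} [NeZero L]

/-- **Dominated convergence along a time curve — the `L¹(du)` convergence of the word correlation for EVERY coupling.**  For a
continuous curve of external times `u ↦ s(u)` with `s(u) ∈ [0,β)^k` for `u ∈ [0,β)` and any pointwise limit `N_∞` of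
`N_M(u) = ∫dμ_{C_M} W_M(s(u)) e^{−V}` on `[0,β)`:  `∫_{[0,β]} ‖N_M(u) − N_∞(u)‖ du ⟶ 0` as `M → ∞`. -/
theorem tendsto_integral_norm_sub_word_allU {β : ℝ} (hβ : 0 < β) (μ U : ℝ) {k m : ℕ} (xe : Fin k → TorusSite 2 L)
    (Pe Qe : Fin m → Fin k × Fin 2) (hPe : Function.Injective Pe) (hQe : Function.Injective Qe)
    {sc : ℝ → Fin k → ℝ} (hsc : Continuous sc) (hscI : ∀ u ∈ Set.Ico (0 : ℝ) β, ∀ p, sc u p ∈ Set.Ico (0 : ℝ) β)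
    {Nl : ℝ → ℂ} (hNl : ∀ u ∈ Set.Ico (0 : ℝ) β, Tendsto (fun M : ℕ => gaussExpect ℂ (hubbardCovariance L M β μ 0)
        ((List.ofFn fun l : Fin m => positionField L M β 0 (Pe l).2 (xe (Pe l).1) (sc u (Pe l).1) *
            positionField L M β 1 (Qe l).2 (xe (Qe l).1) (sc u (Qe l).1)).prod *
          grassmannExp (-(hubbardInteraction L M β U)))) atTop (𝓝 (Nl u))) :
    Tendsto (fun M : ℕ => ∫ u in Set.Icc (0 : ℝ) β, ‖gaussExpect ℂ (hubbardCovariance L M β μ 0)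
        ((List.ofFn fun l : Fin m => positionField L M β 0 (Pe l).2 (xe (Pe l).1) (sc u (Pe l).1) *
            positionField L M β 1 (Qe l).2 (xe (Qe l).1) (sc u (Qe l).1)).prod *
          grassmannExp (-(hubbardInteraction L M β U))) - Nl u‖) atTop (𝓝 0) := by
  obtain ⟨C, hC0, M₀, hMC⟩ := exists_uniform_bound_gaussExpect_word_allU (L := L) hβ μ U xe Pe Qe hPe hQe
  have hae := ae_restrict_Icc_mem_Ico β
  -- measurability of each term (continuity in `u`)
  have hmeas : ∀ M : ℕ, AEStronglyMeasurable (fun u : ℝ => gaussExpect ℂ (hubbardCovariance L M β μ 0)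
      ((List.ofFn fun l : Fin m => positionField L M β 0 (Pe l).2 (xe (Pe l).1) (sc u (Pe l).1) *
            positionField L M β 1 (Qe l).2 (xe (Qe l).1) (sc u (Qe l).1)).prod *
          grassmannExp (-(hubbardInteraction L M β U)))) (volume.restrict (Set.Icc (0 : ℝ) β)) := fun M =>
    ((continuous_gaussExpect_word (L := L) β xe Pe Qe (hubbardCovariance L M β μ 0)
      (grassmannExp (-(hubbardInteraction L M β U)))).comp hsc).aestronglyMeasurable
  -- the limit is a.e.-strongly measurable and bounded by `C` on `[0,β)`
  have hlim_meas : AEStronglyMeasurable Nl (volume.restrict (Set.Icc (0 : ℝ) β)) :=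
    aestronglyMeasurable_of_tendsto_ae atTop hmeas (by filter_upwards [hae] with u hu using hNl u hu)
  have hlimC : ∀ u ∈ Set.Ico (0 : ℝ) β, ‖Nl u‖ ≤ C := by
    intro u hu
    refine le_of_tendsto (hNl u hu).norm ?_
    filter_upwards [eventually_ge_atTop M₀] with M hM
    exact hMC M hM (sc u) fun p => Set.Ico_subset_Icc_self (hscI u hu p)
  have key := tendsto_integral_filter_of_dominated_convergence (μ := volume.restrict (Set.Icc (0 : ℝ) β)) (l := atTop)
    (F := fun (M : ℕ) (u : ℝ) => ‖gaussExpect ℂ (hubbardCovariance L M β μ 0)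
        ((List.ofFn fun l : Fin m => positionField L M β 0 (Pe l).2 (xe (Pe l).1) (sc u (Pe l).1) *
            positionField L M β 1 (Qe l).2 (xe (Qe l).1) (sc u (Qe l).1)).prod *
          grassmannExp (-(hubbardInteraction L M β U))) - Nl u‖) (f := fun _ => (0 : ℝ)) (fun _ => 2 * C) ?_ ?_ ?_ ?_
  · simpa using key
  · exact Eventually.of_forall fun M => ((hmeas M).sub hlim_meas).norm
  · filter_upwards [eventually_ge_atTop M₀] with M hM
    filter_upwards [hae] with u hu
    rw [Real.norm_eq_abs, abs_of_nonneg (norm_nonneg _)]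
    calc ‖gaussExpect ℂ (hubbardCovariance L M β μ 0) ((List.ofFn fun l : Fin m => positionField L M β 0 (Pe l).2 (xe (Pe l).1) (sc u (Pe l).1) *
            positionField L M β 1 (Qe l).2 (xe (Qe l).1) (sc u (Qe l).1)).prod *
          grassmannExp (-(hubbardInteraction L M β U))) - Nl u‖
        ≤ ‖gaussExpect ℂ (hubbardCovariance L M β μ 0) ((List.ofFn fun l : Fin m => positionField L M β 0 (Pe l).2 (xe (Pe l).1) (sc u (Pe l).1) *
            positionField L M β 1 (Qe l).2 (xe (Qe l).1) (sc u (Qe l).1)).prod *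
          grassmannExp (-(hubbardInteraction L M β U)))‖ + ‖Nl u‖ := norm_sub_le _ _
      _ ≤ C + C := add_le_add (hMC M hM (sc u) fun p => Set.Ico_subset_Icc_self (hscI u hu p)) (hlimC u hu)
      _ = 2 * C := by ring
  · exact integrable_const _
  · filter_upwards [hae] with u hu
    have h := (hNl u hu).sub_const (Nl u)
    rw [sub_self] at h
    simpa using h.norm

/-- **Normalised version**: if in addition `z_M → z_∞ ≠ 0` (e.g. `z_M = ∫dμ_{C_M} e^{−V}`), the RATIOS converge in `L¹(du)`:
`∫_{[0,β]} ‖N_M(u)/z_M − N_∞(u)/z_∞‖ du ⟶ 0`. -/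
theorem tendsto_integral_norm_sub_wordRatio_allU {β : ℝ} (hβ : 0 < β) (μ U : ℝ) {k m : ℕ} (xe : Fin k → TorusSite 2 L)
    (Pe Qe : Fin m → Fin k × Fin 2) (hPe : Function.Injective Pe) (hQe : Function.Injective Qe)
    {sc : ℝ → Fin k → ℝ} (hsc : Continuous sc) (hscI : ∀ u ∈ Set.Ico (0 : ℝ) β, ∀ p, sc u p ∈ Set.Ico (0 : ℝ) β)
    {Nl : ℝ → ℂ} (hNl : ∀ u ∈ Set.Ico (0 : ℝ) β, Tendsto (fun M : ℕ => gaussExpect ℂ (hubbardCovariance L M β μ 0)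
        ((List.ofFn fun l : Fin m => positionField L M β 0 (Pe l).2 (xe (Pe l).1) (sc u (Pe l).1) *
            positionField L M β 1 (Qe l).2 (xe (Qe l).1) (sc u (Qe l).1)).prod *
          grassmannExp (-(hubbardInteraction L M β U)))) atTop (𝓝 (Nl u)))
    {z : ℕ → ℂ} {zlim : ℂ} (hz : Tendsto z atTop (𝓝 zlim)) (hzlim : zlim ≠ 0) :
    Tendsto (fun M : ℕ => ∫ u in Set.Icc (0 : ℝ) β, ‖gaussExpect ℂ (hubbardCovariance L M β μ 0)
        ((List.ofFn fun l : Fin m => positionField L M β 0 (Pe l).2 (xe (Pe l).1) (sc u (Pe l).1) *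
            positionField L M β 1 (Qe l).2 (xe (Qe l).1) (sc u (Qe l).1)).prod *
          grassmannExp (-(hubbardInteraction L M β U))) / z M - Nl u / zlim‖) atTop (𝓝 0) := by
  obtain ⟨C, hC0, M₀, hMC⟩ := exists_uniform_bound_gaussExpect_word_allU (L := L) hβ μ U xe Pe Qe hPe hQe
  have hmain := tendsto_integral_norm_sub_word_allU (L := L) hβ μ U xe Pe Qe hPe hQe hsc hscI hNl
  -- abbreviation for the finite-`M` correlation
  set N : ℕ → ℝ → ℂ := fun M u => gaussExpect ℂ (hubbardCovariance L M β μ 0) ((List.ofFn fun l : Fin m => positionField L M β 0 (Pe l).2 (xe (Pe l).1) (sc u (Pe l).1) *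
            positionField L M β 1 (Qe l).2 (xe (Qe l).1) (sc u (Qe l).1)).prod *
          grassmannExp (-(hubbardInteraction L M β U))) with hN
  change Tendsto (fun M : ℕ => ∫ u in Set.Icc (0 : ℝ) β, ‖N M u - Nl u‖) atTop (𝓝 0) at hmain
  change Tendsto (fun M : ℕ => ∫ u in Set.Icc (0 : ℝ) β, ‖N M u / z M - Nl u / zlim‖) atTop (𝓝 0)
  have hae := ae_restrict_Icc_mem_Ico β
  have hlimC : ∀ u ∈ Set.Ico (0 : ℝ) β, ‖Nl u‖ ≤ C := by
    intro u hu
    refine le_of_tendsto (hNl u hu).norm ?_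
    filter_upwards [eventually_ge_atTop M₀] with M hM
    exact hMC M hM (sc u) fun p => Set.Ico_subset_Icc_self (hscI u hu p)
  have hmeas : ∀ M : ℕ, AEStronglyMeasurable (N M) (volume.restrict (Set.Icc (0 : ℝ) β)) := fun M =>
    ((continuous_gaussExpect_word (L := L) β xe Pe Qe (hubbardCovariance L M β μ 0)
      (grassmannExp (-(hubbardInteraction L M β U)))).comp hsc).aestronglyMeasurable
  have hlim_meas : AEStronglyMeasurable Nl (volume.restrict (Set.Icc (0 : ℝ) β)) :=
    aestronglyMeasurable_of_tendsto_ae atTop hmeas (by filter_upwards [hae] with u hu using hNl u hu)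
  -- eventually `‖z_M‖ ≥ ‖z_∞‖/2`
  have hzpos : 0 < ‖zlim‖ := norm_pos_iff.2 hzlim
  have hzev : ∀ᶠ M in atTop, ‖zlim‖ / 2 ≤ ‖z M‖ := by
    have h := (hz.sub_const zlim).norm
    rw [sub_self, norm_zero] at h
    filter_upwards [h.eventually (gt_mem_nhds (half_pos hzpos))] with M hM
    have h1 := norm_sub_norm_le zlim (z M)
    rw [norm_sub_rev] at h1
    linarith
  -- pointwise decomposition and the bound of the integral
  have hdecomp : ∀ᶠ M in atTop, ∫ u in Set.Icc (0 : ℝ) β, ‖N M u / z M - Nl u / zlim‖ ≤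
      (2 / ‖zlim‖) * (∫ u in Set.Icc (0 : ℝ) β, ‖N M u - Nl u‖) + β * (C * ‖(z M)⁻¹ - zlim⁻¹‖) := by
    filter_upwards [hzev, eventually_ge_atTop M₀] with M hM hMM₀
    have hzM : z M ≠ 0 := by
      intro h0; rw [h0, norm_zero] at hM; linarith
    have hpt_le : ∀ᵐ u ∂(volume.restrict (Set.Icc (0 : ℝ) β)), ‖N M u / z M - Nl u / zlim‖ ≤
        (2 / ‖zlim‖) * ‖N M u - Nl u‖ + C * ‖(z M)⁻¹ - zlim⁻¹‖ := by
      filter_upwards [hae] with u hu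
      have hid : N M u / z M - Nl u / zlim = (N M u - Nl u) * (z M)⁻¹ + Nl u * ((z M)⁻¹ - zlim⁻¹) := by
        rw [div_eq_mul_inv, div_eq_mul_inv]; ring
      rw [hid]
      refine (norm_add_le _ _).trans (add_le_add ?_ ?_)
      · rw [norm_mul, norm_inv, mul_comm]
        refine mul_le_mul_of_nonneg_right ?_ (norm_nonneg _)
        rw [inv_le_comm₀ (lt_of_lt_of_le (half_pos hzpos) hM) (by positivity)]
        rw [inv_div]; exact hM
      · rw [norm_mul]
        exact mul_le_mul_of_nonneg_right (hlimC u hu) (norm_nonneg _)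
    have hint : Integrable (fun u => ‖N M u - Nl u‖) (volume.restrict (Set.Icc (0 : ℝ) β)) := by
      refine Integrable.norm (Integrable.sub ?_ ?_)
      · exact (integrable_const C).mono' (hmeas M) (by
          filter_upwards [hae] with u hu
          exact hMC M hMM₀ (sc u) fun p => Set.Ico_subset_Icc_self (hscI u hu p))
      · exact (integrable_const C).mono' hlim_meas (by filter_upwards [hae] with u hu using hlimC u hu)
    have hg : Integrable (fun u => (2 / ‖zlim‖) * ‖N M u - Nl u‖ + C * ‖(z M)⁻¹ - zlim⁻¹‖)
        (volume.restrict (Set.Icc (0 : ℝ) β)) := (hint.const_mul _).add (integrable_const _)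
    have hfm : AEStronglyMeasurable (fun u => ‖N M u / z M - Nl u / zlim‖) (volume.restrict (Set.Icc (0 : ℝ) β)) := by
      simp_rw [div_eq_mul_inv]
      exact (((hmeas M).mul aestronglyMeasurable_const).sub (hlim_meas.mul aestronglyMeasurable_const)).norm
    have hf : Integrable (fun u => ‖N M u / z M - Nl u / zlim‖) (volume.restrict (Set.Icc (0 : ℝ) β)) :=
      hg.mono' hfm (by
        filter_upwards [hpt_le] with u hu
        rw [Real.norm_eq_abs, abs_of_nonneg (norm_nonneg _)]
        exact hu)
    calc ∫ u in Set.Icc (0 : ℝ) β, ‖N M u / z M - Nl u / zlim‖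
        ≤ ∫ u in Set.Icc (0 : ℝ) β, ((2 / ‖zlim‖) * ‖N M u - Nl u‖ + C * ‖(z M)⁻¹ - zlim⁻¹‖) :=
          integral_mono_ae hf hg hpt_le
      _ = (2 / ‖zlim‖) * (∫ u in Set.Icc (0 : ℝ) β, ‖N M u - Nl u‖) + β * (C * ‖(z M)⁻¹ - zlim⁻¹‖) := by
          rw [integral_add (hint.const_mul _) (integrable_const _), integral_const_mul, integral_const, smul_eq_mul,
            measureReal_restrict_apply_univ, Real.volume_real_Icc_of_le hβ.le, sub_zero]
  -- the right-hand side tends to `0`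
  have hinv : Tendsto (fun M => ‖(z M)⁻¹ - zlim⁻¹‖) atTop (𝓝 0) := by
    have h := ((hz.inv₀ hzlim).sub_const zlim⁻¹).norm
    rw [sub_self, norm_zero] at h
    exact h
  have hrhs : Tendsto (fun M => (2 / ‖zlim‖) * (∫ u in Set.Icc (0 : ℝ) β, ‖N M u - Nl u‖) + β * (C * ‖(z M)⁻¹ - zlim⁻¹‖))
      atTop (𝓝 0) := by
    have h := (hmain.const_mul (2 / ‖zlim‖)).add ((hinv.const_mul C).const_mul β)
    simpa using h
  exact squeeze_zero' (Eventually.of_forall fun M => integral_nonneg fun u => norm_nonneg _) hdecomp hrhs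

/-- **The normalised word correlation against the Grassmann partition function converges in `L¹(du)`, for EVERY coupling**
(`L ≥ 3`, `β > 0`): `z_M = ∫dμ_{C_M} e^{−V}`, `z_∞ = e^{−βUL²/4} Z_{H'}/Z_{H₀} ≠ 0` (t2's `tendsto_effPartitionFn_hubbard_eq_partitionFn_div_allU`). -/
theorem tendsto_integral_norm_sub_wordRatio_effPartitionFn_allU (hL : 3 ≤ L) {β : ℝ} (hβ : 0 < β) (μ U : ℝ) {k m : ℕ}
    (xe : Fin k → TorusSite 2 L) (Pe Qe : Fin m → Fin k × Fin 2) (hPe : Function.Injective Pe) (hQe : Function.Injective Qe)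
    {sc : ℝ → Fin k → ℝ} (hsc : Continuous sc) (hscI : ∀ u ∈ Set.Ico (0 : ℝ) β, ∀ p, sc u p ∈ Set.Ico (0 : ℝ) β)
    {Nl : ℝ → ℂ} (hNl : ∀ u ∈ Set.Ico (0 : ℝ) β, Tendsto (fun M : ℕ => gaussExpect ℂ (hubbardCovariance L M β μ 0)
        ((List.ofFn fun l : Fin m => positionField L M β 0 (Pe l).2 (xe (Pe l).1) (sc u (Pe l).1) *
            positionField L M β 1 (Qe l).2 (xe (Qe l).1) (sc u (Qe l).1)).prod *
          grassmannExp (-(hubbardInteraction L M β U)))) atTop (𝓝 (Nl u))) :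
    Tendsto (fun M : ℕ => ∫ u in Set.Icc (0 : ℝ) β, ‖gaussExpect ℂ (hubbardCovariance L M β μ 0)
        ((List.ofFn fun l : Fin m => positionField L M β 0 (Pe l).2 (xe (Pe l).1) (sc u (Pe l).1) *
            positionField L M β 1 (Qe l).2 (xe (Qe l).1) (sc u (Qe l).1)).prod *
          grassmannExp (-(hubbardInteraction L M β U))) / effPartitionFn ℂ (hubbardCovariance L M β μ 0) (hubbardInteraction L M β U) -
        Nl u / (((Real.exp (-(β * U / 4 * (L : ℝ) ^ 2)) : ℂ) * Matrix.partitionFn β (hubbardTorusWith 2 L 1 U (μ + U / 2)) /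
            Matrix.partitionFn β (hubbardTorusWith 2 L 1 0 μ)))‖) atTop (𝓝 0) := by
  haveI : Nonempty (Finset (Orb (FermionTorus 2 L))) := ⟨∅⟩
  have hZ' : Matrix.partitionFn β (hubbardTorusWith 2 L 1 U (μ + U / 2)) ≠ 0 :=
    (Matrix.partitionFn_pos β (isHermitian_hamiltonianWith (fermionTorusGraph 2 L) 1 U (μ + U / 2))).ne'
  have hZ₀ : Matrix.partitionFn β (hubbardTorusWith 2 L 1 0 μ) ≠ 0 :=
    (Matrix.partitionFn_pos β (isHermitian_hamiltonianWith (fermionTorusGraph 2 L) 1 0 μ)).ne'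
  have he : ((Real.exp (-(β * U / 4 * (L : ℝ) ^ 2)) : ℝ) : ℂ) ≠ 0 := by exact_mod_cast (Real.exp_pos _).ne'
  exact tendsto_integral_norm_sub_wordRatio_allU hβ μ U xe Pe Qe hPe hQe hsc hscI hNl
    (tendsto_effPartitionFn_hubbard_eq_partitionFn_div_allU hL hβ μ U) (div_ne_zero (mul_ne_zero he hZ') hZ₀)

omit [NeZero L] in
/-- **Fourier–Matsubara coefficients are dominated by the `L¹` distance, uniformly in the frequency**: for every real `ω` and any
set `S`, `‖∫_S e^{iωu}(f(u) − g(u)) du‖ ≤ ∫_S ‖f(u) − g(u)‖ du`. -/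
theorem norm_setIntegral_cexp_mul_sub_le (f g : ℝ → ℂ) (ω : ℝ) (S : Set ℝ) :
    ‖∫ u in S, Complex.exp (Complex.I * ω * u) * (f u - g u)‖ ≤ ∫ u in S, ‖f u - g u‖ := by
  refine (norm_integral_le_integral_norm _).trans (le_of_eq (integral_congr_ae (Eventually.of_forall fun u => ?_)))
  have h1 : ‖Complex.exp (Complex.I * ω * u)‖ = 1 := by
    rw [Complex.norm_exp]
    simp
  simp only [norm_mul, h1, one_mul]

end

end Summit.HubbardSuperconductivity.HubbardSuperconductivity.Theorems.MatsubaraAllU
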